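import Summits.Ventures.Crystal3D.Theorems.StickyWulffConstantTextureLiminfTexShadowOnReachSplit
import Summits.Ventures.Crystal3D.Theorems.StickyWulffConstantGenericWallFloorBarlowRowCovGlueApart
import HarnessLib

/-!
# TexShadow §2c — the WEAK-ZIG part of the on-reach split: CLOSED on zig-frame-generic pairs (modulo E1), three ZIG-KEYED
# coincidence classes otherwise (lane T, crux `TextureLiminf`, stmt-Ventures-19483, line `TexShadow` v6.15 / `…TexShadowOnReachSplit`;
# supplied by lane G, crux `GenericWallFloor`, stmt-Ventures-19480 — wulff-p2 g15 2026-08-28T21:51:16Z «or a G lemma»)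

HONEST FRAMING. Venture `Summits/Ventures/Crystal3D` (cell `crystal3d-full`), helper `--supports`; rung credit only; F-C1 not moved.
Definitions (named sub-parts of `BilayerWallOnReachWeakZig`, p671420) + proved glue + ONE sub-part closed modulo E1 / `StarPairFar`;
the three coincidence classes are NOT proved here.

THE POINT.  `…TexShadowOnReachSplit` leaves the class W = `BilayerWallOnReachWeakZig`: both plates Δ-steep, table flux-dominated, NOT
row-mix-dominated, positionally on-reach, and SOME plate not `ZigGood` — there the corner OF RECORD (`cornerFrames`) runs ROWS, so the key
`FramesApart` speaks about the row family and neither F4 applies.  But lane G's zig corner does not need `ZigGood`: 19480-p2 g8's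
`barlow_hlines_zigApart` (`…GenericWallFloorBarlowCoverableGlueApart`, p668937) proves the zig covered `hlines` from `DeltaSteep₁ ∧ DeltaSteep₂`
and the three FRAME clauses of the ZIG families `zigFrames L z := chainFrames z (upFrame L z) (famSlot L z)` alone (`ZigGood` entered
`barlow_hlines_framesApart` only to unfold `cornerFrames` to `zigFrames`).  Hence:
* `zigFrames`, **`ZigFramesApart L₁ s₁ σ₁ L₂ s₂ σ₂`** — the three zig-frame clauses (translation- and word-free; `= FramesApart` when both
  plates are `ZigGood`: `zigFramesApart_iff_framesApart`);
* **`BilayerWallZigFramesApart C R₀`** — `DeltaSteep₁ → DeltaSteep₂ → ZigFramesApart → FluxDominated(√2/2) c → BilayerWallAt`, **CLOSED modulo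
  E1 / StarPairFar** from thickness `6` (`bilayerWallZigFramesApartFrom_of_cert`); wulff-p2's `BilayerWallZigApart` is its `ZigGood` instance
  (`bilayerWallZigApart_of_zigFramesApart`), and so is the zig-frame-generic part of W;
* three ZIG-KEYED coincidence classes with W's full hypothesis list — **`BilayerWallZigShared`** (ZO1: a zig frame of one plate carries the
  other plate's bilayer lattice), **`BilayerWallZigTwin`** (ZO2: … its basal twin's), **`BilayerWallZigCoaxial`** (ZO3: a zig frame of plate 1 is
  Barlow-coaxial with a zig frame of plate 2) — the same REGISTERED orientation classes as O1–O3 (word-registered pairs), keyed on the zig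
  family's frames instead of the corner-of-record's; owners as for O1–O3 (lane F's `CoaxialWallLaw` as a hypothesis / lane G's registered
  accounting); `zigFrameClasses_of_not_zigFramesApart`;
* glue **`bilayerWallOnReachWeakZigFrom_of_zigSplit`**: ZigFramesApart-part ∪ ZO1 ∪ ZO2 ∪ ZO3 ⇒ `BilayerWallOnReachWeakZigFrom (max …)` (pure logic),
  and the one-call composition **`bilayerWallOnReachAllFrom_of_zigSplit`** (row-covered ∪ zig-frames-apart ∪ O1–O3 ∪ ZO1–ZO3 ⇒ on-reach).
So after this file lane T's on-reach debt is {O1, O2, O3, ZO1, ZO2, ZO3} = registered classes only; no (L3) certificate is owed for W.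
WHAT THIS IS NOT: the six coincidence classes are NOT proved; no import of `CoaxialWallLaw`'s proof; F-C1 not moved.
-/

noncomputable section

open scoped BigOperators InnerProductSpace ENNReal
open MeasureTheory Filter

namespace Summit.Ventures.Crystal3D.Cruxes.TextureLiminf.TexShadow

open Summit.Ventures.Crystal3D Summit.Ventures.Crystal3D.Theorems
open Literature.MathematicalPhysics.StatisticalMechanics (IsHaggSeq fccStacking)

/-! ## The zig family's frames and the zig-keyed off-reach predicate -/

/-- **The frames of the ZIG family of the plate `L` walked toward `z`**: the forced chain frames of the up-presentation launched along the
family slot (the frame set of `cornerFrames` when the plate is `ZigGood`, but defined for every plate). -/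
def zigFrames (L : E3 ≃ₗᵢ[ℝ] E3) (z : E3) : Set (E3 ≃ₗᵢ[ℝ] E3) :=
  chainFrames z (upFrame L z) (famSlot L z)

/-- **`ZigFramesApart`** — `FramesApart`'s three clauses for the ZIG families of both plates (regardless of `ZigGood`): (i) no zig frame of
plate 1 carries plate 2's bilayer lattice or its basal twin's, (ii) symmetrically, (iii) no zig frame of plate 1 is Barlow-coaxial with a
zig frame of plate 2.  Translation-free and word-free (the arguments `s₁, σ₁, s₂, σ₂` are carried only to have `OffR`'s signature). -/
def ZigFramesApart (L₁ : E3 ≃ₗᵢ[ℝ] E3) (_s₁ : E3) (_σ₁ : ℤ → ℤ) (L₂ : E3 ≃ₗᵢ[ℝ] E3) (_s₂ : E3) (_σ₂ : ℤ → ℤ) : Prop :=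
  (∀ F ∈ zigFrames L₁ e₃,
    F '' fccStacking 1 (Real.sqrt (2 / 3)) ≠ L₂ '' fccStacking 1 (Real.sqrt (2 / 3)) ∧
    F '' fccStacking 1 (Real.sqrt (2 / 3)) ≠ (twinFrame L₂ (L₂ e₃)) '' fccStacking 1 (Real.sqrt (2 / 3))) ∧
  (∀ F ∈ zigFrames L₂ (-e₃),
    F '' fccStacking 1 (Real.sqrt (2 / 3)) ≠ L₁ '' fccStacking 1 (Real.sqrt (2 / 3)) ∧
    F '' fccStacking 1 (Real.sqrt (2 / 3)) ≠ (twinFrame L₁ (L₁ e₃)) '' fccStacking 1 (Real.sqrt (2 / 3))) ∧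
  (∀ F₁ ∈ zigFrames L₁ e₃, ∀ F₂ ∈ zigFrames L₂ (-e₃), ¬ CoAxFrames F₁ F₂)

/-- `ZigFramesApart` does not depend on the origins or the words. -/
theorem zigFramesApart_iff_zero (L₁ L₂ : E3 ≃ₗᵢ[ℝ] E3) (s₁ s₂ : E3) (σ₁ σ₂ τ₁ τ₂ : ℤ → ℤ) :
    ZigFramesApart L₁ s₁ σ₁ L₂ s₂ σ₂ ↔ ZigFramesApart L₁ 0 τ₁ L₂ 0 τ₂ := Iff.rfl

/-- For a `ZigGood` plate the corner of record runs the zig family: `cornerFrames = zigFrames`. -/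
theorem cornerFrames_eq_zigFrames {L : E3 ≃ₗᵢ[ℝ] E3} {σ : ℤ → ℤ} {z : E3} (h : ZigGood L σ z) :
    cornerFrames L σ z = zigFrames L z :=
  (corner_of_zigGood h 0).2.2.1

/-- **When both plates are `ZigGood`, `ZigFramesApart` IS `FramesApart`.** -/
theorem zigFramesApart_iff_framesApart {L₁ L₂ : E3 ≃ₗᵢ[ℝ] E3} {σ₁ σ₂ : ℤ → ℤ} (s₁ s₂ : E3)
    (h₁ : ZigGood L₁ σ₁ e₃) (h₂ : ZigGood L₂ σ₂ (-e₃)) :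
    ZigFramesApart L₁ s₁ σ₁ L₂ s₂ σ₂ ↔ FramesApart L₁ s₁ σ₁ L₂ s₂ σ₂ := by
  unfold ZigFramesApart FramesApart
  rw [cornerFrames_eq_zigFrames h₁, cornerFrames_eq_zigFrames h₂]

/-- `ZigGood` plates: `FramesApart ⇒ ZigFramesApart`. -/
theorem zigFramesApart_of_framesApart {L₁ L₂ : E3 ≃ₗᵢ[ℝ] E3} {σ₁ σ₂ : ℤ → ℤ} {s₁ s₂ : E3}
    (h₁ : ZigGood L₁ σ₁ e₃) (h₂ : ZigGood L₂ σ₂ (-e₃)) (h : FramesApart L₁ s₁ σ₁ L₂ s₂ σ₂) :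
    ZigFramesApart L₁ s₁ σ₁ L₂ s₂ σ₂ :=
  (zigFramesApart_iff_framesApart s₁ s₂ h₁ h₂).2 h

/-- `¬ ZigFramesApart` unfolds into the three ZIG-KEYED frame classes. -/
theorem zigFrameClasses_of_not_zigFramesApart {L₁ L₂ : E3 ≃ₗᵢ[ℝ] E3} {s₁ s₂ : E3} {σ₁ σ₂ : ℤ → ℤ}
    (h : ¬ ZigFramesApart L₁ s₁ σ₁ L₂ s₂ σ₂) :
    ((∃ F ∈ zigFrames L₁ e₃, F '' fccStacking 1 (Real.sqrt (2 / 3)) = L₂ '' fccStacking 1 (Real.sqrt (2 / 3))) ∨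
      (∃ F ∈ zigFrames L₂ (-e₃), F '' fccStacking 1 (Real.sqrt (2 / 3)) = L₁ '' fccStacking 1 (Real.sqrt (2 / 3)))) ∨
    ((∃ F ∈ zigFrames L₁ e₃,
        F '' fccStacking 1 (Real.sqrt (2 / 3)) = (twinFrame L₂ (L₂ e₃)) '' fccStacking 1 (Real.sqrt (2 / 3))) ∨
      (∃ F ∈ zigFrames L₂ (-e₃),
        F '' fccStacking 1 (Real.sqrt (2 / 3)) = (twinFrame L₁ (L₁ e₃)) '' fccStacking 1 (Real.sqrt (2 / 3)))) ∨
    (∃ F₁ ∈ zigFrames L₁ e₃, ∃ F₂ ∈ zigFrames L₂ (-e₃), CoAxFrames F₁ F₂) := by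
  by_contra hno
  push Not at hno
  obtain ⟨⟨h1a, h1b⟩, ⟨h2a, h2b⟩, h3⟩ := hno
  exact h ⟨fun F hF => ⟨h1a F hF, h2a F hF⟩, fun F hF => ⟨h1b F hF, h2b F hF⟩, fun F₁ hF₁ F₂ hF₂ => h3 F₁ hF₁ F₂ hF₂⟩

/-! ## The four named sub-parts of W -/

/-- **ZIG-FRAMES-APART PART** at `(C, R₀)`: both plates Δ-steep, ZIG frames apart, flux-dominated admissible tables (NO `ZigGood`, no
positional reach clause, no row condition). -/
def BilayerWallZigFramesApart (C R₀ : ℝ) : Prop :=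
  ∀ (σ₁ σ₂ : ℤ → ℤ), IsHaggSeq σ₁ → IsHaggSeq σ₂ →
    ∀ (L₁ L₂ : E3 ≃ₗᵢ[ℝ] E3) (s₁ s₂ : E3) (A₁ A₂ : ℤ → (E3 ≃ₗᵢ[ℝ] E3)) (u₁ u₂ : ℤ → E3),
    BilayerFramesAt L₁ s₁ σ₁ A₁ u₁ → BilayerFramesAt L₂ s₂ σ₂ A₂ u₂ →
    (∀ i j : ℤ, ¬ InResidualClass (A₁ i) (A₂ j) (u₁ i) (u₂ j)) →
    DeltaSteep L₁ e₃ → DeltaSteep L₂ (-e₃) → ZigFramesApart L₁ s₁ σ₁ L₂ s₂ σ₂ →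
    ∀ (c : ℤ → ℤ → ℝ) (m : ℤ → ℤ → E3), BilayerChargeAdmissible A₁ A₂ c m →
      FluxDominated (Real.sqrt 2 / 2) L₁ σ₁ L₂ σ₂ c →
      BilayerWallAt C R₀ σ₁ σ₂ L₁ L₂ s₁ s₂ c

/-- **WEAK ZIG, SHARED LATTICE (ZO1)** at `(C, R₀)`: W's hypotheses, and some ZIG frame of one plate carries the other plate's bilayer lattice. -/
def BilayerWallZigShared (C R₀ : ℝ) : Prop :=
  ∀ (σ₁ σ₂ : ℤ → ℤ), IsHaggSeq σ₁ → IsHaggSeq σ₂ →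
    ∀ (L₁ L₂ : E3 ≃ₗᵢ[ℝ] E3) (s₁ s₂ : E3) (A₁ A₂ : ℤ → (E3 ≃ₗᵢ[ℝ] E3)) (u₁ u₂ : ℤ → E3),
    BilayerFramesAt L₁ s₁ σ₁ A₁ u₁ → BilayerFramesAt L₂ s₂ σ₂ A₂ u₂ →
    (∀ i j : ℤ, ¬ InResidualClass (A₁ i) (A₂ j) (u₁ i) (u₂ j)) →
    ∀ (c : ℤ → ℤ → ℝ) (m : ℤ → ℤ → E3), BilayerChargeAdmissible A₁ A₂ c m →
      DeltaSteep L₁ e₃ → DeltaSteep L₂ (-e₃) → FluxDominated (Real.sqrt 2 / 2) L₁ σ₁ L₂ σ₂ c →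
      ¬ BarlowOffReach L₁ s₁ σ₁ L₂ s₂ σ₂ → ¬ RowMixDominated (Real.sqrt 2 / 2) L₁ σ₁ L₂ σ₂ c →
      ¬ (ZigGood L₁ σ₁ e₃ ∧ ZigGood L₂ σ₂ (-e₃)) →
      ((∃ F ∈ zigFrames L₁ e₃, F '' fccStacking 1 (Real.sqrt (2 / 3)) = L₂ '' fccStacking 1 (Real.sqrt (2 / 3))) ∨
        (∃ F ∈ zigFrames L₂ (-e₃), F '' fccStacking 1 (Real.sqrt (2 / 3)) = L₁ '' fccStacking 1 (Real.sqrt (2 / 3)))) →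
      BilayerWallAt C R₀ σ₁ σ₂ L₁ L₂ s₁ s₂ c

/-- **WEAK ZIG, TWIN LATTICE (ZO2)** at `(C, R₀)`: W's hypotheses, and some ZIG frame of one plate carries the other plate's BASAL-TWIN lattice. -/
def BilayerWallZigTwin (C R₀ : ℝ) : Prop :=
  ∀ (σ₁ σ₂ : ℤ → ℤ), IsHaggSeq σ₁ → IsHaggSeq σ₂ →
    ∀ (L₁ L₂ : E3 ≃ₗᵢ[ℝ] E3) (s₁ s₂ : E3) (A₁ A₂ : ℤ → (E3 ≃ₗᵢ[ℝ] E3)) (u₁ u₂ : ℤ → E3),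
    BilayerFramesAt L₁ s₁ σ₁ A₁ u₁ → BilayerFramesAt L₂ s₂ σ₂ A₂ u₂ →
    (∀ i j : ℤ, ¬ InResidualClass (A₁ i) (A₂ j) (u₁ i) (u₂ j)) →
    ∀ (c : ℤ → ℤ → ℝ) (m : ℤ → ℤ → E3), BilayerChargeAdmissible A₁ A₂ c m →
      DeltaSteep L₁ e₃ → DeltaSteep L₂ (-e₃) → FluxDominated (Real.sqrt 2 / 2) L₁ σ₁ L₂ σ₂ c →
      ¬ BarlowOffReach L₁ s₁ σ₁ L₂ s₂ σ₂ → ¬ RowMixDominated (Real.sqrt 2 / 2) L₁ σ₁ L₂ σ₂ c →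
      ¬ (ZigGood L₁ σ₁ e₃ ∧ ZigGood L₂ σ₂ (-e₃)) →
      ((∃ F ∈ zigFrames L₁ e₃,
          F '' fccStacking 1 (Real.sqrt (2 / 3)) = (twinFrame L₂ (L₂ e₃)) '' fccStacking 1 (Real.sqrt (2 / 3))) ∨
        (∃ F ∈ zigFrames L₂ (-e₃),
          F '' fccStacking 1 (Real.sqrt (2 / 3)) = (twinFrame L₁ (L₁ e₃)) '' fccStacking 1 (Real.sqrt (2 / 3)))) →
      BilayerWallAt C R₀ σ₁ σ₂ L₁ L₂ s₁ s₂ c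

/-- **WEAK ZIG, COAXIAL FRAMES (ZO3)** at `(C, R₀)`: W's hypotheses, and a ZIG frame of plate 1 is Barlow-coaxial with a ZIG frame of plate 2. -/
def BilayerWallZigCoaxial (C R₀ : ℝ) : Prop :=
  ∀ (σ₁ σ₂ : ℤ → ℤ), IsHaggSeq σ₁ → IsHaggSeq σ₂ →
    ∀ (L₁ L₂ : E3 ≃ₗᵢ[ℝ] E3) (s₁ s₂ : E3) (A₁ A₂ : ℤ → (E3 ≃ₗᵢ[ℝ] E3)) (u₁ u₂ : ℤ → E3),
    BilayerFramesAt L₁ s₁ σ₁ A₁ u₁ → BilayerFramesAt L₂ s₂ σ₂ A₂ u₂ →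
    (∀ i j : ℤ, ¬ InResidualClass (A₁ i) (A₂ j) (u₁ i) (u₂ j)) →
    ∀ (c : ℤ → ℤ → ℝ) (m : ℤ → ℤ → E3), BilayerChargeAdmissible A₁ A₂ c m →
      DeltaSteep L₁ e₃ → DeltaSteep L₂ (-e₃) → FluxDominated (Real.sqrt 2 / 2) L₁ σ₁ L₂ σ₂ c →
      ¬ BarlowOffReach L₁ s₁ σ₁ L₂ s₂ σ₂ → ¬ RowMixDominated (Real.sqrt 2 / 2) L₁ σ₁ L₂ σ₂ c →
      ¬ (ZigGood L₁ σ₁ e₃ ∧ ZigGood L₂ σ₂ (-e₃)) →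
      (∃ F₁ ∈ zigFrames L₁ e₃, ∃ F₂ ∈ zigFrames L₂ (-e₃), CoAxFrames F₁ F₂) →
      BilayerWallAt C R₀ σ₁ σ₂ L₁ L₂ s₁ s₂ c

/-- `From` form of the zig-frames-apart part. -/
def BilayerWallZigFramesApartFrom (R : ℝ) : Prop := ∀ R₀ : ℝ, R ≤ R₀ → ∃ C : ℝ, BilayerWallZigFramesApart C R₀
/-- `From` form of ZO1. -/
def BilayerWallZigSharedFrom (R : ℝ) : Prop := ∀ R₀ : ℝ, R ≤ R₀ → ∃ C : ℝ, BilayerWallZigShared C R₀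
/-- `From` form of ZO2. -/
def BilayerWallZigTwinFrom (R : ℝ) : Prop := ∀ R₀ : ℝ, R ≤ R₀ → ∃ C : ℝ, BilayerWallZigTwin C R₀
/-- `From` form of ZO3. -/
def BilayerWallZigCoaxialFrom (R : ℝ) : Prop := ∀ R₀ : ℝ, R ≤ R₀ → ∃ C : ℝ, BilayerWallZigCoaxial C R₀

/-! ## The zig-frames-apart part is closed modulo E1 / StarPairFar -/

/-- **ZIG-FRAMES-APART PART from thickness `6`, modulo E1 (`hsE`, `hcert`) and the `StarPairFar` facts (`hDS`, `hCP`)**: lane G's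
`barlow_hlines_zigApart` (Δ-steep plates, zig frames apart — no `ZigGood`) fed into T's `bilayerWallAt_of_lineCount`. -/
theorem bilayerWallZigFramesApartFrom_of_cert
    {sE : E3} (hsE : sE ∈ fccSlots) (hcert : ExactOnly 0 (fccSlots.filter fun w => 0 < ⟪w, sE⟫_ℝ))
    (hDS : ∀ F₁ F₂ : E3 ≃ₗᵢ[ℝ] E3, DoubleStarCoaxialAt F₁ F₂) (hCP : CapPairCoaxial) :
    BilayerWallZigFramesApartFrom 6 := by
  intro R₀ hR₀
  refine ⟨((318 + 192 * R₀) + 80 * (R₀ + 9) + 3456 + 1152 * (R₀ + 1)) / 2, ?_⟩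
  intro σ₁ σ₂ hσ₁ hσ₂ L₁ L₂ s₁ s₂ A₁ A₂ u₁ u₂ _ _ _ hΔ₁ hΔ₂ hZA c m hadm hFD
  have he₃' : e₃ = EuclideanSpace.single (2 : Fin 3) (1 : ℝ) := rfl
  obtain ⟨hA1, hA2, hA3⟩ := hZA
  unfold zigFrames at hA1 hA2 hA3
  rw [he₃'] at hA1 hA2 hA3 hΔ₁ hΔ₂
  obtain ⟨step₁, step₂, hsel₁, hsel₂, hF4⟩ :=
    barlow_hlines_zigApart hsE hcert hDS hCP R₀ hR₀ hσ₁ hσ₂ L₁ L₂ s₁ s₂ hA1 hA2 hA3 hΔ₁ hΔ₂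
  exact bilayerWallAt_of_lineCount hσ₁ hσ₂ L₁ L₂ s₁ s₂ (Real.sqrt 2 / 2) R₀ (318 + 192 * R₀) (by linarith) c hadm.1 hFD
    hsel₁ hsel₂ hF4

/-- wulff-p2's zig-apart part (`ZigGood` plates, `FramesApart`) is an instance of the zig-frames-apart part. -/
theorem bilayerWallZigApart_of_zigFramesApart {C R₀ : ℝ} (h : BilayerWallZigFramesApart C R₀) : BilayerWallZigApart C R₀ :=
  fun σ₁ σ₂ hσ₁ hσ₂ L₁ L₂ s₁ s₂ A₁ A₂ u₁ u₂ hu₁ hu₂ hgen hZ₁ hZ₂ hFA c m hadm hFD =>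
    h σ₁ σ₂ hσ₁ hσ₂ L₁ L₂ s₁ s₂ A₁ A₂ u₁ u₂ hu₁ hu₂ hgen hZ₁.1 hZ₂.1 (zigFramesApart_of_framesApart hZ₁ hZ₂ hFA) c m hadm hFD

/-- `From` form of the previous lemma. -/
theorem bilayerWallZigApartFrom_of_zigFramesApartFrom {R : ℝ} (h : BilayerWallZigFramesApartFrom R) : BilayerWallZigApartFrom R :=
  fun R₀ hR₀ => by obtain ⟨C, hC⟩ := h R₀ hR₀; exact ⟨C, bilayerWallZigApart_of_zigFramesApart hC⟩

/-! ## The composition -/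

/-- **Glue: zig-frames-apart ∪ ZO1 ∪ ZO2 ∪ ZO3 ⇒ W** (`BilayerWallOnReachWeakZigFrom`, pure logic: `ZigFramesApart` or one of the three
zig-keyed classes; `hA1 : 1 ≤ R_A` only feeds the monotonicity of the cell inequality in the rim constant). -/
theorem bilayerWallOnReachWeakZigFrom_of_zigSplit {R_A R_S R_T R_C : ℝ} (hA1 : 1 ≤ R_A)
    (hA : BilayerWallZigFramesApartFrom R_A) (hS : BilayerWallZigSharedFrom R_S) (hT : BilayerWallZigTwinFrom R_T)
    (hC : BilayerWallZigCoaxialFrom R_C) :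
    BilayerWallOnReachWeakZigFrom (max (max R_A R_S) (max R_T R_C)) := by
  classical
  intro R₀ hR₀
  have hRA : R_A ≤ R₀ := (le_max_left _ _).trans ((le_max_left _ _).trans hR₀)
  obtain ⟨C₁, hC₁⟩ := hA R₀ hRA
  obtain ⟨C₂, hC₂⟩ := hS R₀ ((le_max_right _ _).trans ((le_max_left _ _).trans hR₀))
  obtain ⟨C₃, hC₃⟩ := hT R₀ ((le_max_left _ _).trans ((le_max_right _ _).trans hR₀))
  obtain ⟨C₄, hC₄⟩ := hC R₀ ((le_max_right _ _).trans ((le_max_right _ _).trans hR₀))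
  have hR₀0 : 0 ≤ R₀ := by linarith
  set C : ℝ := max (max C₁ C₂) (max C₃ C₄) with hCdef
  have e1 : C₁ ≤ C := (le_max_left _ _).trans (le_max_left _ _)
  have e2 : C₂ ≤ C := (le_max_right _ _).trans (le_max_left _ _)
  have e3 : C₃ ≤ C := (le_max_left _ _).trans (le_max_right _ _)
  have e4 : C₄ ≤ C := (le_max_right _ _).trans (le_max_right _ _)
  refine ⟨C, ?_⟩
  intro σ₁ σ₂ hσ₁ hσ₂ L₁ L₂ s₁ s₂ A₁ A₂ u₁ u₂ hu₁ hu₂ hgen c m hadm hΔ₁ hΔ₂ hFD hBOR hRow hZG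
  by_cases hZA : ZigFramesApart L₁ s₁ σ₁ L₂ s₂ σ₂
  · exact bilayerWallAt_mono hR₀0 e1 (hC₁ σ₁ σ₂ hσ₁ hσ₂ L₁ L₂ s₁ s₂ A₁ A₂ u₁ u₂ hu₁ hu₂ hgen hΔ₁ hΔ₂ hZA c m hadm hFD)
  · rcases zigFrameClasses_of_not_zigFramesApart hZA with h | h | h
    · exact bilayerWallAt_mono hR₀0 e2
        (hC₂ σ₁ σ₂ hσ₁ hσ₂ L₁ L₂ s₁ s₂ A₁ A₂ u₁ u₂ hu₁ hu₂ hgen c m hadm hΔ₁ hΔ₂ hFD hBOR hRow hZG h)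
    · exact bilayerWallAt_mono hR₀0 e3
        (hC₃ σ₁ σ₂ hσ₁ hσ₂ L₁ L₂ s₁ s₂ A₁ A₂ u₁ u₂ hu₁ hu₂ hgen c m hadm hΔ₁ hΔ₂ hFD hBOR hRow hZG h)
    · exact bilayerWallAt_mono hR₀0 e4
        (hC₄ σ₁ σ₂ hσ₁ hσ₂ L₁ L₂ s₁ s₂ A₁ A₂ u₁ u₂ hu₁ hu₂ hgen c m hadm hΔ₁ hΔ₂ hFD hBOR hRow hZG h)

/-- **One-call composition for `stub_bilayerWallOnReachAll`**: row-covered (`FramesApart`, from `R_R ≥ 1`) ∪ zig-frames-apart (from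
`R_A ≥ 1`) ∪ O1 ∪ O2 ∪ O3 ∪ ZO1 ∪ ZO2 ∪ ZO3 ⇒ `BilayerWallOnReachAllFrom FramesApart _` (wulff-p2's `bilayerWallOnReachAll_of_split` with its
zig-apart input instantiated from the zig-frames-apart part and its W input from `bilayerWallOnReachWeakZigFrom_of_zigSplit`). -/
theorem bilayerWallOnReachAllFrom_of_zigSplit {R_R R_A R_S R_T R_C R_ZS R_ZT R_ZC : ℝ} (hR1 : 1 ≤ R_R) (hA1 : 1 ≤ R_A)
    (hR : BilayerWallRowCovFrom FramesApart R_R) (hA : BilayerWallZigFramesApartFrom R_A)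
    (hS : BilayerWallOnReachSharedFrom R_S) (hT : BilayerWallOnReachTwinFrom R_T) (hC : BilayerWallOnReachCoaxialFrom R_C)
    (hZS : BilayerWallZigSharedFrom R_ZS) (hZT : BilayerWallZigTwinFrom R_ZT) (hZC : BilayerWallZigCoaxialFrom R_ZC) :
    BilayerWallOnReachAllFrom FramesApart
      (max (max R_R R_A) (max (max R_S R_T) (max R_C (max (max R_A R_ZS) (max R_ZT R_ZC))))) :=
  bilayerWallOnReachAll_of_split hR1 hR (bilayerWallZigApartFrom_of_zigFramesApartFrom hA) hS hT hC
    (bilayerWallOnReachWeakZigFrom_of_zigSplit hA1 hA hZS hZT hZC)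

/-- **The same, with the two CLOSED parts discharged modulo E1 / StarPairFar** (the v6.17 closing term of `stub_bilayerWallOnReachAll` up to the
six registered-class stubs): only O1–O3 and ZO1–ZO3 remain as inputs. -/
theorem bilayerWallOnReachAllFrom_of_classes
    {sE : E3} (hsE : sE ∈ fccSlots) (hcert : ExactOnly 0 (fccSlots.filter fun w => 0 < ⟪w, sE⟫_ℝ))
    (hDS : ∀ F₁ F₂ : E3 ≃ₗᵢ[ℝ] E3, DoubleStarCoaxialAt F₁ F₂) (hCP : CapPairCoaxial)
    {R_S R_T R_C R_ZS R_ZT R_ZC : ℝ}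
    (hS : BilayerWallOnReachSharedFrom R_S) (hT : BilayerWallOnReachTwinFrom R_T) (hC : BilayerWallOnReachCoaxialFrom R_C)
    (hZS : BilayerWallZigSharedFrom R_ZS) (hZT : BilayerWallZigTwinFrom R_ZT) (hZC : BilayerWallZigCoaxialFrom R_ZC) :
    ∃ R : ℝ, BilayerWallOnReachAllFrom FramesApart R :=
  ⟨_, bilayerWallOnReachAllFrom_of_zigSplit (by norm_num : (1 : ℝ) ≤ 6) (by norm_num : (1 : ℝ) ≤ 6)
    (bilayerWallRowCovFrom_framesApart hsE hcert hDS hCP) (bilayerWallZigFramesApartFrom_of_cert hsE hcert hDS hCP)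
    hS hT hC hZS hZT hZC⟩

end Summit.Ventures.Crystal3D.Cruxes.TextureLiminf.TexShadow

end
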